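import Literature.Barriers.Parity.SiegelZeroDichotomyPairHLHyperbolaFourier
import Literature.NumberTheory.Sieve.MontgomeryVaughan1975GaussSums
import Literature.NumberTheory.Sieve.BombieriVinogradovReduction
import Literature.NumberTheory.LFunctions.TaoLogChowlaMoebiusOfLiouville
import HarnessLib

/-!
# Tao–Teräväinen 2022, Lemma 3.9: the modified Fourier expansion on a hyperbola

Topic `Literature/Barriers/Parity`, sub-namespace `TaoTeravainen`; a file of the proof DAG of
`Literature.Barriers.Parity.TaoTeravainen2021_prop72_81_pair` (T. Tao, J. Teräväinen, *The
Hardy–Littlewood–Chowla conjecture in the presence of a Siegel zero*, J. London Math. Soc. (2) 106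
(2022), arXiv:2109.06291), §3.5, after `SiegelZeroDichotomyPairHLHyperbolaFourier.lean`
(Lemma 3.8). Everything here is PROVED.

The source: "the contribution of those terms in which one of `u₁, u₂` is divisible by `q` (or by a
very large factor of `q`) will be inconvenient to handle. We therefore perform the following
substitute expansion: **Lemma 3.9.** Let `q₀ ∣ q` with `(a,q) ∣ q₀`, `f` `1`-bounded with period
`q₀`, `q₀' := (q₀(a,q), q)`. Then
`f(n₁,n₂) 1_{n₁n₂ = a (q)} = (α q₀'/q) f(n₁,n₂) 1_{n₁n₂ = a (q₀')} 1_{(n₁n₂,q) = (a,q)} + ∑_{u₁,u₂ : q/q₀ ∤ u₁,u₂} c_{u₁,u₂} e_q(u₁n₁+u₂n₂)`,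
`|c_{u₁,u₂}| ≤ 2 τ(q₀)² q₀^{3/2} τ(q) q^{-3/2} (u₁,u₂,q)^{1/2}`."

We follow the printed proof with one cosmetic change: the average over the set `𝒜` of residues
`a' ≡ a (q₀')`, `(a',q) = (a,q)` is taken over the units `w ≡ 1 (q₀)` parametrising it
(`a' = wa`; the source: "since `(a',q) = (a,q)`, we can write `a' = wa` … we may in fact assume
that `w = 1 (q₀)`"), which gives the same main term `ρ₀ 1_𝒜(n₁n₂)` with
`0 ≤ ρ₀ ≤ q₀' τ(q)/q` in place of the exactly computed `α q₀'/q`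
(`α = ∏_{p ∣ q/q₀', p ∤ q₀'/(a,q)} p/(p-1)`); only this upper bound is used downstream
(Proposition 7.1).

* `unitsOne` (`U₁`), `hyperbolaCoeff_unit_mul_eq` — the invariance of the hyperbola coefficients
  under `a ↦ wa` at the bad frequencies (the source's (3.19)–(3.20), "the change of variables
  `n₂ ↦ w n₂`");
* `orbitWeight`, `modifiedCoeff`, `modifiedCoeff_eq_zero` (vanishing unless `q/q₀ ∤ u₁, u₂`),
  `norm_modifiedCoeff_le` (twice Lemma 3.8), `indicator_mul_eq_orbitWeight_add_sum` (Fourier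
  inversion);
* `orbit_subset`, `exists_unit_of_mem` (the orbit `U₁a` is exactly `𝒜`; Chinese remainder
  theorem), `card_orbitStab_mul_le`, `orbitWeight_structure` (`ρ = ρ₀ 1_𝒜`, `ρ₀ q ≤ q₀' τ(q)`,
  using `|fibre| φ(d) = φ(q)` from `Literature/NumberTheory/Sieve/MontgomeryVaughan1975GaussSums.lean`
  and `m ≤ φ(m)τ(m)` from `Literature/NumberTheory/Sieve/BombieriVinogradovReduction.lean`);
* **`modifiedFourierExpansion`** — Lemma 3.9 as stated above.
  [cite: TaoTeravainen2021, Lemma 3.9]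
-/

noncomputable section

open Finset Complex

namespace Literature.Barriers.Parity

namespace TaoTeravainen

open Literature.NumberTheory.Sieve.MontgomeryVaughan1975 (card_fiber_mul_totient)

variable {Q : ℕ} [NeZero Q]

/-! ### The units `≡ 1 (mod q₀)` -/

/-- The subgroup `U₁ = {w ∈ (ℤ/Qℤ)ˣ : w ≡ 1 (mod q₀)}` (kernel of `(ℤ/Q)ˣ → (ℤ/q₀)ˣ`) as a
finset. [cite: TaoTeravainen2021, proof of Lemma 3.9 ("we may in fact assume that `w = 1 (q₀)`")] -/
def unitsOne {q₀ : ℕ} (hq₀ : q₀ ∣ Q) : Finset (ZMod Q)ˣ :=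
  Finset.univ.filter fun w => ZMod.unitsMap hq₀ w = 1

/-- Membership in `U₁`. [folklore] -/
theorem mem_unitsOne {q₀ : ℕ} (hq₀ : q₀ ∣ Q) {w : (ZMod Q)ˣ} :
    w ∈ unitsOne hq₀ ↔ ZMod.unitsMap hq₀ w = 1 := by
  simp [unitsOne]

/-- `1 ∈ U₁`. [folklore] -/
theorem one_mem_unitsOne {q₀ : ℕ} (hq₀ : q₀ ∣ Q) : (1 : (ZMod Q)ˣ) ∈ unitsOne hq₀ := by
  rw [mem_unitsOne, map_one]

/-- `U₁` is closed under products. [folklore] -/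
theorem mul_mem_unitsOne {q₀ : ℕ} (hq₀ : q₀ ∣ Q) {w w' : (ZMod Q)ˣ} (hw : w ∈ unitsOne hq₀)
    (hw' : w' ∈ unitsOne hq₀) : w * w' ∈ unitsOne hq₀ := by
  rw [mem_unitsOne] at *
  rw [map_mul, hw, hw', one_mul]

/-- `U₁` is closed under inverses. [folklore] -/
theorem inv_mem_unitsOne {q₀ : ℕ} (hq₀ : q₀ ∣ Q) {w : (ZMod Q)ˣ} (hw : w ∈ unitsOne hq₀) :
    w⁻¹ ∈ unitsOne hq₀ := by
  rw [mem_unitsOne] at *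
  rw [map_inv, hw, inv_one]

/-- `|U₁| φ(q₀) = φ(Q)`. [folklore] -/
theorem card_unitsOne_mul_totient {q₀ : ℕ} [NeZero q₀] (hq₀ : q₀ ∣ Q) :
    (unitsOne (Q := Q) hq₀).card * Nat.totient q₀ = Nat.totient Q :=
  card_fiber_mul_totient hq₀ 1

/-- `U₁` is non-empty. [folklore] -/
theorem card_unitsOne_pos {q₀ : ℕ} (hq₀ : q₀ ∣ Q) : 0 < (unitsOne (Q := Q) hq₀).card :=
  Finset.card_pos.mpr ⟨1, one_mem_unitsOne hq₀⟩

/-- A unit `w ≡ 1 (mod q₀)` has `w - 1 = q₀ k` in `ℤ/Qℤ`. [folklore] -/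
theorem exists_sub_one_eq_of_mem_unitsOne {q₀ : ℕ} (hq₀ : q₀ ∣ Q) {w : (ZMod Q)ˣ}
    (hw : w ∈ unitsOne hq₀) : ∃ k : ZMod Q, (w : ZMod Q) - 1 = (q₀ : ZMod Q) * k := by
  rw [mem_unitsOne] at hw
  have h1 : ((ZMod.unitsMap hq₀ w : (ZMod q₀)ˣ) : ZMod q₀) = 1 := by rw [hw, Units.val_one]
  rw [ZMod.unitsMap_val] at h1
  -- `(w - 1 : ZMod Q)` maps to `0` in `ZMod q₀`
  have h2 : (ZMod.castHom hq₀ (ZMod q₀)) ((w : ZMod Q) - 1) = 0 := by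
    rw [map_sub, map_one, ZMod.castHom_apply, h1, sub_self]
  rw [ZMod.castHom_apply, ZMod.cast_eq_val, ZMod.natCast_eq_zero_iff] at h2
  obtain ⟨j, hj⟩ := h2
  refine ⟨(j : ZMod Q), ?_⟩
  rw [← Nat.cast_mul, ← hj, ZMod.natCast_zmod_val]

/-- `q₀`-periodicity in steps extends to all multiples `q₀ k`, `k ∈ ℤ/Qℤ`. [folklore] -/
theorem periodic_mul_of_periodic {α : Type*} (g : ZMod Q → α) {q₀ : ℕ}
    (hg : ∀ n, g (n + (q₀ : ZMod Q)) = g n) (n k : ZMod Q) : g (n + (q₀ : ZMod Q) * k) = g n := by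
  rw [← ZMod.natCast_zmod_val k]
  induction k.val with
  | zero => simp
  | succ j ih =>
    rw [Nat.cast_succ, mul_add, mul_one, ← add_assoc, hg, ih]


/-! ### The key invariance: replacing `a` by `wa`, `w ≡ 1 (q₀)`, at the bad frequencies -/

/-- **The vanishing step of Lemma 3.9.** If `w` is a unit with `w ≡ 1 (mod q₀)`, `f` is
`q₀`-periodic in each variable, and `u₂ q₀ = 0` (i.e. `Q/q₀ ∣ u₂`) or `u₁ q₀ = 0`, then the
hyperbola coefficients at `a` and at `wa` coincide ("the change of variables `n₂ ↦ w n₂`").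
[cite: TaoTeravainen2021, proof of Lemma 3.9 (the claim (3.19)–(3.20))] -/
theorem hyperbolaCoeff_unit_mul_eq {q₀ : ℕ} (hq₀ : q₀ ∣ Q) {f : ZMod Q × ZMod Q → ℂ}
    (hfp₁ : ∀ n, f (n + ((q₀ : ZMod Q), 0)) = f n) (hfp₂ : ∀ n, f (n + (0, (q₀ : ZMod Q))) = f n)
    {w : (ZMod Q)ˣ} (hw : w ∈ unitsOne hq₀) (a : ZMod Q) {u : ZMod Q × ZMod Q}
    (hu : u.1 * (q₀ : ZMod Q) = 0 ∨ u.2 * (q₀ : ZMod Q) = 0) :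
    hyperbolaCoeff f ((w : ZMod Q) * a) u = hyperbolaCoeff f a u := by
  classical
  obtain ⟨k, hk⟩ := exists_sub_one_eq_of_mem_unitsOne hq₀ hw
  have hw' : (w : ZMod Q) = 1 + (q₀ : ZMod Q) * k := by rw [← hk]; ring
  unfold hyperbolaCoeff
  congr 1
  rcases hu with hu₁ | hu₂
  · -- substitute `n₁ ↦ w n₁`
    rw [Fintype.sum_prod_type, Fintype.sum_prod_type,
      ← Equiv.sum_comp (Units.mulLeft w) (fun n₁ => ∑ n₂ : ZMod Q,
        if (n₁, n₂).1 * (n₁, n₂).2 = (w : ZMod Q) * a then f (n₁, n₂) * eQ u (n₁, n₂) else 0)]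
    refine Finset.sum_congr rfl fun n₁ _ => Finset.sum_congr rfl fun n₂ _ => ?_
    change (if ((w : ZMod Q) * n₁, n₂).1 * ((w : ZMod Q) * n₁, n₂).2 = (w : ZMod Q) * a then
      f (((w : ZMod Q) * n₁), n₂) * eQ u (((w : ZMod Q) * n₁), n₂) else 0) =
      if (n₁, n₂).1 * (n₁, n₂).2 = a then f (n₁, n₂) * eQ u (n₁, n₂) else 0
    simp only
    have hcond : ((w : ZMod Q) * n₁) * n₂ = (w : ZMod Q) * a ↔ n₁ * n₂ = a := by
      rw [mul_assoc, Units.mul_right_inj]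
    have hf : f (((w : ZMod Q) * n₁), n₂) = f (n₁, n₂) := by
      have hper : ∀ m : ZMod Q, f (m + (q₀ : ZMod Q), n₂) = f (m, n₂) := by
        intro m
        have := hfp₁ (m, n₂)
        rwa [Prod.mk_add_mk, add_zero] at this
      have h := periodic_mul_of_periodic (fun m => f (m, n₂)) hper n₁ (k * n₁)
      rw [hw', show (1 + (q₀ : ZMod Q) * k) * n₁ = n₁ + (q₀ : ZMod Q) * (k * n₁) by ring, h]
    have he : eQ u (((w : ZMod Q) * n₁), n₂) = eQ u (n₁, n₂) := by
      unfold eQ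
      congr 1
      simp only [hw']
      linear_combination (k * n₁) * hu₁
    by_cases h : n₁ * n₂ = a
    · rw [if_pos (hcond.mpr h), if_pos h, hf, he]
    · rw [if_neg (fun h' => h (hcond.mp h')), if_neg h]
  · -- substitute `n₂ ↦ w n₂`
    rw [Fintype.sum_prod_type, Fintype.sum_prod_type]
    refine Finset.sum_congr rfl fun n₁ _ => ?_
    rw [← Equiv.sum_comp (Units.mulLeft w) (fun n₂ =>
        if (n₁, n₂).1 * (n₁, n₂).2 = (w : ZMod Q) * a then f (n₁, n₂) * eQ u (n₁, n₂) else 0)]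
    refine Finset.sum_congr rfl fun n₂ _ => ?_
    change (if (n₁, (w : ZMod Q) * n₂).1 * (n₁, (w : ZMod Q) * n₂).2 = (w : ZMod Q) * a then
      f (n₁, ((w : ZMod Q) * n₂)) * eQ u (n₁, ((w : ZMod Q) * n₂)) else 0) =
      if (n₁, n₂).1 * (n₁, n₂).2 = a then f (n₁, n₂) * eQ u (n₁, n₂) else 0
    simp only
    have hcond : n₁ * ((w : ZMod Q) * n₂) = (w : ZMod Q) * a ↔ n₁ * n₂ = a := by
      rw [mul_left_comm, Units.mul_right_inj]
    have hf : f (n₁, ((w : ZMod Q) * n₂)) = f (n₁, n₂) := by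
      have hper : ∀ m : ZMod Q, f (n₁, m + (q₀ : ZMod Q)) = f (n₁, m) := by
        intro m
        have := hfp₂ (n₁, m)
        rwa [Prod.mk_add_mk, add_zero] at this
      have h := periodic_mul_of_periodic (fun m => f (n₁, m)) hper n₂ (k * n₂)
      rw [hw', show (1 + (q₀ : ZMod Q) * k) * n₂ = n₂ + (q₀ : ZMod Q) * (k * n₂) by ring, h]
    have he : eQ u (n₁, ((w : ZMod Q) * n₂)) = eQ u (n₁, n₂) := by
      unfold eQ
      congr 1
      simp only [hw']
      linear_combination (k * n₂) * hu₂
    by_cases h : n₁ * n₂ = a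
    · rw [if_pos (hcond.mpr h), if_pos h, hf, he]
    · rw [if_neg (fun h' => h (hcond.mp h')), if_neg h]

/-! ### The orbit weight and the modified coefficients -/

/-- The averaged indicator `ρ(m) = #{w ∈ U₁ : w a = m}/|U₁| = 𝔼_{w ∈ U₁} 1_{m = wa}` (the
source's `𝔼_{a' ∈ 𝒜} 1_{n = a' (q)}`, averaged over the units `w ≡ 1 (q₀)` rather than over the
distinct `a' = wa`). [cite: TaoTeravainen2021, Lemma 3.9] -/
def orbitWeight {q₀ : ℕ} (hq₀ : q₀ ∣ Q) (a m : ZMod Q) : ℂ :=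
  (((unitsOne hq₀).filter fun w : (ZMod Q)ˣ => (w : ZMod Q) * a = m).card : ℂ) / (unitsOne hq₀).card

/-- `ρ(m)` as a normalised sum of indicators. [folklore] -/
theorem orbitWeight_eq_sum_div {q₀ : ℕ} (hq₀ : q₀ ∣ Q) (a m : ZMod Q) :
    orbitWeight hq₀ a m =
      (∑ w ∈ unitsOne hq₀, if (w : ZMod Q) * a = m then (1 : ℂ) else 0) / (unitsOne hq₀).card := by
  classical
  unfold orbitWeight
  congr 1
  rw [Finset.card_filter]
  push_cast
  exact Finset.sum_congr rfl fun w _ => by split_ifs <;> rfl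

/-- The coefficients `c_{u₁,u₂}` of Lemma 3.9: the Fourier coefficients of
`f(n) (1_{n₁n₂ = a} - ρ(n₁n₂))`. [cite: TaoTeravainen2021, Lemma 3.9] -/
def modifiedCoeff {q₀ : ℕ} (hq₀ : q₀ ∣ Q) (f : ZMod Q × ZMod Q → ℂ) (a : ZMod Q)
    (u : ZMod Q × ZMod Q) : ℂ :=
  coeff2 (fun n => f n * ((if n.1 * n.2 = a then (1 : ℂ) else 0) - orbitWeight hq₀ a (n.1 * n.2))) u

/-- `coeff2` of `f 1_{n₁n₂ = b}` is the hyperbola coefficient at `-u`. [folklore] -/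
theorem coeff2_indicator_eq_hyperbolaCoeff (f : ZMod Q × ZMod Q → ℂ) (b : ZMod Q)
    (u : ZMod Q × ZMod Q) :
    coeff2 (fun n => f n * (if n.1 * n.2 = b then (1 : ℂ) else 0)) u = hyperbolaCoeff f b (-u) := by
  unfold coeff2 hyperbolaCoeff
  congr 1
  refine Finset.sum_congr rfl fun n _ => ?_
  have he : eQ u (-n) = eQ (-u) n := by
    unfold eQ
    congr 1
    simp only [Prod.fst_neg, Prod.snd_neg]
    ring
  dsimp only
  split_ifs with h
  · rw [mul_one, he]
  · rw [mul_zero, zero_mul]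

/-- `coeff2` is additive: subtraction. [folklore] -/
theorem coeff2_sub (A B : ZMod Q × ZMod Q → ℂ) (u : ZMod Q × ZMod Q) :
    coeff2 (fun n => A n - B n) u = coeff2 A u - coeff2 B u := by
  unfold coeff2
  rw [← sub_div, ← Finset.sum_sub_distrib]
  congr 1
  refine Finset.sum_congr rfl fun n _ => ?_
  ring

/-- `coeff2` commutes with finite sums. [folklore] -/
theorem coeff2_finset_sum {ι : Type*} (s : Finset ι) (A : ι → ZMod Q × ZMod Q → ℂ)
    (u : ZMod Q × ZMod Q) :
    coeff2 (fun n => ∑ i ∈ s, A i n) u = ∑ i ∈ s, coeff2 (A i) u := by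
  unfold coeff2
  rw [← Finset.sum_div]
  congr 1
  rw [Finset.sum_comm]
  refine Finset.sum_congr rfl fun n _ => ?_
  rw [Finset.sum_mul]

/-- `coeff2` is homogeneous. [folklore] -/
theorem coeff2_const_mul (c : ℂ) (A : ZMod Q × ZMod Q → ℂ) (u : ZMod Q × ZMod Q) :
    coeff2 (fun n => c * A n) u = c * coeff2 A u := by
  unfold coeff2
  rw [mul_div_assoc', Finset.mul_sum]
  congr 1
  refine Finset.sum_congr rfl fun n _ => ?_
  ring

/-- The modified coefficient is the hyperbola coefficient minus its average over the orbit: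
`c_u = 𝔼f1_{=a}(-u) - 𝔼_{w ∈ U₁} 𝔼f1_{=wa}(-u)`. [cite: TaoTeravainen2021, proof of Lemma 3.9] -/
theorem modifiedCoeff_eq {q₀ : ℕ} (hq₀ : q₀ ∣ Q) (f : ZMod Q × ZMod Q → ℂ) (a : ZMod Q)
    (u : ZMod Q × ZMod Q) :
    modifiedCoeff hq₀ f a u = hyperbolaCoeff f a (-u) -
      (∑ w ∈ unitsOne hq₀, hyperbolaCoeff f ((w : ZMod Q) * a) (-u)) / (unitsOne hq₀).card := by
  classical
  set N : ℕ := (unitsOne hq₀).card with hN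
  have hF : (fun n : ZMod Q × ZMod Q =>
      f n * ((if n.1 * n.2 = a then (1 : ℂ) else 0) - orbitWeight hq₀ a (n.1 * n.2))) =
      fun n => (f n * (if n.1 * n.2 = a then (1 : ℂ) else 0)) -
        (1 / (N : ℂ)) * ∑ w ∈ unitsOne hq₀, f n * (if n.1 * n.2 = (w : ZMod Q) * a then (1 : ℂ) else 0) := by
    funext n
    rw [orbitWeight_eq_sum_div, mul_sub]
    congr 1
    rw [mul_div_assoc', Finset.mul_sum, Finset.sum_div, Finset.mul_sum]
    refine Finset.sum_congr rfl fun w _ => ?_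
    by_cases hc : n.1 * n.2 = (w : ZMod Q) * a
    · rw [if_pos hc, if_pos hc.symm]
      rw [hN]
      ring
    · rw [if_neg hc, if_neg (fun h' => hc h'.symm)]
      ring
  unfold modifiedCoeff
  rw [hF, coeff2_sub, coeff2_const_mul, coeff2_finset_sum, coeff2_indicator_eq_hyperbolaCoeff]
  simp_rw [coeff2_indicator_eq_hyperbolaCoeff]
  rw [one_div, inv_mul_eq_div]

/-- **Vanishing at the bad frequencies**: `c_u = 0` whenever `u₁ q₀ = 0` or `u₂ q₀ = 0` in `ℤ/Qℤ`
(i.e. `Q/q₀` divides `u₁` or `u₂`). [cite: TaoTeravainen2021, Lemma 3.9] -/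
theorem modifiedCoeff_eq_zero {q₀ : ℕ} (hq₀ : q₀ ∣ Q) {f : ZMod Q × ZMod Q → ℂ}
    (hfp₁ : ∀ n, f (n + ((q₀ : ZMod Q), 0)) = f n) (hfp₂ : ∀ n, f (n + (0, (q₀ : ZMod Q))) = f n)
    (a : ZMod Q) {u : ZMod Q × ZMod Q} (hu : u.1 * (q₀ : ZMod Q) = 0 ∨ u.2 * (q₀ : ZMod Q) = 0) :
    modifiedCoeff hq₀ f a u = 0 := by
  rw [modifiedCoeff_eq]
  have hu' : (-u).1 * (q₀ : ZMod Q) = 0 ∨ (-u).2 * (q₀ : ZMod Q) = 0 := by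
    rcases hu with h | h
    · left; rw [Prod.fst_neg, neg_mul, h, neg_zero]
    · right; rw [Prod.snd_neg, neg_mul, h, neg_zero]
  have hconst : ∀ w ∈ unitsOne hq₀, hyperbolaCoeff f ((w : ZMod Q) * a) (-u) = hyperbolaCoeff f a (-u) :=
    fun w hw => hyperbolaCoeff_unit_mul_eq hq₀ hfp₁ hfp₂ hw a hu'
  rw [Finset.sum_congr rfl hconst, Finset.sum_const, nsmul_eq_mul,
    mul_div_cancel_left₀ _ (Nat.cast_ne_zero.mpr (card_unitsOne_pos hq₀).ne'), sub_self]

omit [NeZero Q] in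
/-- `(−u₁,−u₂,Q) = (u₁,u₂,Q)`. [folklore] -/
theorem gcd_val_neg (u : ZMod Q × ZMod Q) :
    Nat.gcd (Nat.gcd (-u).1.val (-u).2.val) Q = Nat.gcd (Nat.gcd u.1.val u.2.val) Q := by
  have hunit : IsUnit (-1 : ZMod Q) := isUnit_one.neg
  have h1 : Nat.gcd (-u).1.val Q = Nat.gcd u.1.val Q := by
    rw [Prod.fst_neg, show -u.1 = (-1) * u.1 by ring, gcd_val_mul_unit u.1 hunit]
  have h2 : Nat.gcd (-u).2.val Q = Nat.gcd u.2.val Q := by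
    rw [Prod.snd_neg, show -u.2 = (-1) * u.2 by ring, gcd_val_mul_unit u.2 hunit]
  -- `gcd(gcd(A,B),Q) = gcd(gcd(A,Q), gcd(B,Q))`
  have key : ∀ A B : ℕ, Nat.gcd (Nat.gcd A B) Q = Nat.gcd (Nat.gcd A Q) (Nat.gcd B Q) := by
    intro A B
    refine Nat.dvd_antisymm ?_ ?_
    · refine Nat.dvd_gcd (Nat.dvd_gcd ?_ (Nat.gcd_dvd_right _ _)) (Nat.dvd_gcd ?_ (Nat.gcd_dvd_right _ _))
      · exact (Nat.gcd_dvd_left _ _).trans (Nat.gcd_dvd_left _ _)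
      · exact (Nat.gcd_dvd_left _ _).trans (Nat.gcd_dvd_right _ _)
    · refine Nat.dvd_gcd (Nat.dvd_gcd ?_ ?_) ((Nat.gcd_dvd_left _ _).trans (Nat.gcd_dvd_right _ _))
      · exact (Nat.gcd_dvd_left _ _).trans (Nat.gcd_dvd_left _ _)
      · exact (Nat.gcd_dvd_right _ _).trans (Nat.gcd_dvd_left _ _)
  rw [key, h1, h2, ← key]

/-- **The bound on `c_u`**: `|c_u| ≤ 2 τ(q₀)² q₀^{3/2} τ(Q) Q^{-3/2} (u₁,u₂,Q)^{1/2}` (twice the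
bound of Lemma 3.8, which applies to `a` and to every `wa`). [cite: TaoTeravainen2021, Lemma 3.9] -/
theorem norm_modifiedCoeff_le {q₀ : ℕ} (hq₀ : q₀ ∣ Q) {a : ZMod Q} (ha : Nat.gcd a.val Q ∣ q₀)
    {f : ZMod Q × ZMod Q → ℂ} (hf1 : ∀ n, ‖f n‖ ≤ 1)
    (hfp₁ : ∀ n, f (n + ((q₀ : ZMod Q), 0)) = f n) (hfp₂ : ∀ n, f (n + (0, (q₀ : ZMod Q))) = f n)
    (u : ZMod Q × ZMod Q) :
    ‖modifiedCoeff hq₀ f a u‖ ≤ 2 * (((Nat.divisors q₀).card : ℝ) ^ 2 * ((q₀ : ℝ) * Real.sqrt q₀) *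
      (Nat.divisors Q).card * Real.sqrt (Nat.gcd (Nat.gcd u.1.val u.2.val) Q) /
        ((Q : ℝ) * Real.sqrt Q)) := by
  rw [modifiedCoeff_eq, ← gcd_val_neg u]
  set B : ℝ := ((Nat.divisors q₀).card : ℝ) ^ 2 * ((q₀ : ℝ) * Real.sqrt q₀) *
      (Nat.divisors Q).card * Real.sqrt (Nat.gcd (Nat.gcd (-u).1.val (-u).2.val) Q) /
        ((Q : ℝ) * Real.sqrt Q) with hB
  have h1 : ‖hyperbolaCoeff f a (-u)‖ ≤ B := norm_hyperbolaCoeff_le hq₀ ha hf1 hfp₁ hfp₂ (-u)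
  have h2 : ∀ w ∈ unitsOne hq₀, ‖hyperbolaCoeff f ((w : ZMod Q) * a) (-u)‖ ≤ B := by
    intro w _
    refine norm_hyperbolaCoeff_le hq₀ ?_ hf1 hfp₁ hfp₂ (-u)
    rwa [gcd_val_mul_unit a (Units.isUnit w)]
  have hN : (0 : ℝ) < (unitsOne hq₀).card := by exact_mod_cast card_unitsOne_pos hq₀
  calc ‖hyperbolaCoeff f a (-u) -
        (∑ w ∈ unitsOne hq₀, hyperbolaCoeff f ((w : ZMod Q) * a) (-u)) / (unitsOne hq₀).card‖
      ≤ ‖hyperbolaCoeff f a (-u)‖ +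
          ‖(∑ w ∈ unitsOne hq₀, hyperbolaCoeff f ((w : ZMod Q) * a) (-u)) / ((unitsOne hq₀).card : ℂ)‖ :=
        norm_sub_le _ _
    _ ≤ B + (∑ w ∈ unitsOne hq₀, B) / (unitsOne hq₀).card := by
        gcongr
        rw [norm_div, Complex.norm_natCast]
        gcongr
        exact (norm_sum_le _ _).trans (Finset.sum_le_sum h2)
    _ = 2 * B := by
        rw [Finset.sum_const, nsmul_eq_mul, mul_div_cancel_left₀ _ hN.ne', two_mul]

/-- **The expansion of Lemma 3.9**:
`f(n) 1_{n₁n₂ = a} = f(n) ρ(n₁n₂) + ∑_u c_u e_Q(u·n)`. [cite: TaoTeravainen2021, Lemma 3.9] -/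
theorem indicator_mul_eq_orbitWeight_add_sum {q₀ : ℕ} (hq₀ : q₀ ∣ Q) (f : ZMod Q × ZMod Q → ℂ)
    (a : ZMod Q) (n : ZMod Q × ZMod Q) :
    (if n.1 * n.2 = a then f n else 0) =
      f n * orbitWeight hq₀ a (n.1 * n.2) + ∑ u : ZMod Q × ZMod Q, modifiedCoeff hq₀ f a u * eQ u n := by
  unfold modifiedCoeff
  rw [sum_coeff2_mul_eQ]
  rw [mul_sub, add_sub_cancel]
  split_ifs <;> simp


/-! ### The orbit `U₁ a` and the structure of the averaged indicator -/

/-- Congruence of representatives modulo a divisor `d ∣ Q` is equality of the images in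
`ℤ/dℤ`. [folklore] -/
theorem val_modEq_iff_castHom_eq {d : ℕ} (hd : d ∣ Q) (m a : ZMod Q) :
    m.val ≡ a.val [MOD d] ↔ ZMod.castHom hd (ZMod d) m = ZMod.castHom hd (ZMod d) a := by
  rw [ZMod.castHom_apply, ZMod.castHom_apply, ZMod.cast_eq_val, ZMod.cast_eq_val,
    ZMod.natCast_eq_natCast_iff]

/-- A unit `w ≡ 1 (q₀)` has representative `w.val ≡ 1 (mod q₀)`. [folklore] -/
theorem val_modEq_one_of_mem_unitsOne {q₀ : ℕ} (hq₀ : q₀ ∣ Q) {w : (ZMod Q)ˣ}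
    (hw : w ∈ unitsOne hq₀) : (w : ZMod Q).val ≡ 1 [MOD q₀] := by
  rw [mem_unitsOne] at hw
  have h1 : ((ZMod.unitsMap hq₀ w : (ZMod q₀)ˣ) : ZMod q₀) = 1 := by rw [hw, Units.val_one]
  rw [ZMod.unitsMap_val, ZMod.cast_eq_val] at h1
  rw [← ZMod.natCast_eq_natCast_iff, Nat.cast_one]
  exact h1

/-- **The orbit is contained in the source's `𝒜`**: for `w ∈ U₁`, `m = wa` satisfies
`m ≡ a (mod q₀')`, `q₀' = (q₀ a, Q)`, and `(m, Q) = (a, Q)`. [cite: TaoTeravainen2021, proof of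
Lemma 3.9] -/
theorem orbit_subset {q₀ : ℕ} (hq₀ : q₀ ∣ Q) (a : ZMod Q) {w : (ZMod Q)ˣ} (hw : w ∈ unitsOne hq₀) :
    ((w : ZMod Q) * a).val ≡ a.val [MOD Nat.gcd (q₀ * a.val) Q] ∧
      Nat.gcd ((w : ZMod Q) * a).val Q = Nat.gcd a.val Q := by
  refine ⟨?_, gcd_val_mul_unit a (Units.isUnit w)⟩
  have hdvd : Nat.gcd (q₀ * a.val) Q ∣ Q := Nat.gcd_dvd_right _ _
  rw [val_modEq_iff_castHom_eq hdvd]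
  obtain ⟨k, hk⟩ := exists_sub_one_eq_of_mem_unitsOne hq₀ hw
  have hw' : (w : ZMod Q) = 1 + (q₀ : ZMod Q) * k := by rw [← hk]; ring
  have hqa : (ZMod.castHom hdvd (ZMod (Nat.gcd (q₀ * a.val) Q))) ((q₀ : ZMod Q) * a) = 0 := by
    have : (q₀ : ZMod Q) * a = ((q₀ * a.val : ℕ) : ZMod Q) := by
      push_cast; rw [ZMod.natCast_zmod_val]
    rw [this, map_natCast, ZMod.natCast_eq_zero_iff]
    exact Nat.gcd_dvd_left _ _
  rw [hw', add_mul, one_mul, map_add, mul_assoc, mul_left_comm, map_mul, hqa, mul_zero, add_zero]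

/-- **The source's `𝒜` is contained in the orbit**: if `m ≡ a (mod (q₀a, Q))` and
`(m, Q) = (a, Q) ∣ q₀`, there is a unit `w ≡ 1 (q₀)` with `m = wa` ("since `(a',q) = (a,q)` we can
write `a' = wa` for some primitive `w`; … we may in fact assume that `w = 1 (q₀)`"; Chinese
remainder theorem). [cite: TaoTeravainen2021, proof of Lemma 3.9] -/
theorem exists_unit_of_mem {q₀ : ℕ} (hq₀ : q₀ ∣ Q) {a : ZMod Q} (ha : Nat.gcd a.val Q ∣ q₀)
    {m : ZMod Q} (hm₁ : m.val ≡ a.val [MOD Nat.gcd (q₀ * a.val) Q])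
    (hm₂ : Nat.gcd m.val Q = Nat.gcd a.val Q) :
    ∃ w ∈ unitsOne hq₀, (w : ZMod Q) * a = m := by
  classical
  have hQ0 : Q ≠ 0 := NeZero.ne Q
  have hQpos : 0 < Q := Nat.pos_of_ne_zero hQ0
  -- notation: `g = (a,Q)`, `Q = g Q₁`, `a = g a₁`, `m = g m₁`
  obtain ⟨g, hg⟩ : ∃ g : ℕ, g = Nat.gcd a.val Q := ⟨_, rfl⟩
  have hg0 : 0 < g := by rw [hg]; exact Nat.gcd_pos_of_pos_right _ hQpos
  obtain ⟨Q₁, hQ₁⟩ : g ∣ Q := by rw [hg]; exact Nat.gcd_dvd_right _ _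
  obtain ⟨a₁, ha₁⟩ : g ∣ a.val := by rw [hg]; exact Nat.gcd_dvd_left _ _
  obtain ⟨m₁, hm₁'⟩ : g ∣ m.val := by rw [hg, ← hm₂]; exact Nat.gcd_dvd_left _ _
  have hQ₁0 : Q₁ ≠ 0 := by rintro rfl; rw [mul_zero] at hQ₁; exact hQ0 hQ₁
  haveI : NeZero Q₁ := ⟨hQ₁0⟩
  have hcopa : Nat.Coprime a₁ Q₁ := by
    have h := Nat.coprime_div_gcd_div_gcd (m := a.val) (n := Q) (by rw [← hg]; exact hg0)
    rw [← hg, ha₁, hQ₁, Nat.mul_div_cancel_left _ hg0, Nat.mul_div_cancel_left _ hg0] at h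
    exact h
  have hcopm : Nat.Coprime m₁ Q₁ := by
    have h := Nat.coprime_div_gcd_div_gcd (m := m.val) (n := Q) (by rw [hm₂, ← hg]; exact hg0)
    rw [hm₂, ← hg, hm₁', hQ₁, Nat.mul_div_cancel_left _ hg0, Nat.mul_div_cancel_left _ hg0] at h
    exact h
  -- `q₀' = g (q₀, Q₁)`
  have hq₀' : Nat.gcd (q₀ * a.val) Q = g * Nat.gcd q₀ Q₁ := by
    rw [ha₁, hQ₁, show q₀ * (g * a₁) = g * (q₀ * a₁) by ring, Nat.gcd_mul_left,
      Nat.Coprime.gcd_mul_right_cancel q₀ hcopa]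
  -- an inverse of `a₁` modulo `Q₁`
  obtain ⟨ab, hab⟩ : ∃ ab : ℕ, a₁ * ab ≡ 1 [MOD Q₁] := by
    refine ⟨((a₁ : ZMod Q₁)⁻¹).val, ?_⟩
    rw [← ZMod.natCast_eq_natCast_iff, Nat.cast_mul, ZMod.natCast_zmod_val, Nat.cast_one]
    exact ZMod.coe_mul_inv_eq_one a₁ hcopa
  -- the target residue `r₀ = m₁ a₁⁻¹ (mod Q₁)`, `≡ 1 (mod (q₀, Q₁))`
  have hm₁a₁ : m₁ ≡ a₁ [MOD Nat.gcd q₀ Q₁] := by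
    have h : g * m₁ ≡ g * a₁ [MOD g * Nat.gcd q₀ Q₁] := by
      rw [← hm₁', ← ha₁, ← hq₀']; exact hm₁
    exact Nat.ModEq.mul_left_cancel' hg0.ne' h
  have hr₀ : m₁ * ab ≡ 1 [MOD Nat.gcd Q₁ q₀] := by
    rw [Nat.gcd_comm]
    have h1 : m₁ * ab ≡ a₁ * ab [MOD Nat.gcd q₀ Q₁] := hm₁a₁.mul_right _
    exact h1.trans (hab.of_dvd (Nat.gcd_dvd_right _ _))
  -- Chinese remainder: `r ≡ m₁ ab (mod Q₁)`, `r ≡ 1 (mod q₀)`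
  obtain ⟨r, hr₁, hr₂⟩ := Nat.chineseRemainder' hr₀
  -- `r` is coprime to `Q = g Q₁`
  have hcopr : Nat.Coprime r Q := by
    rw [hQ₁]
    refine Nat.Coprime.mul_right ?_ ?_
    · have hg_q₀ : g ∣ q₀ := by rw [hg]; exact ha
      have : r ≡ 1 [MOD g] := hr₂.of_dvd hg_q₀
      rw [Nat.Coprime, this.gcd_eq, Nat.gcd_one_left]
    · rw [Nat.Coprime, hr₁.gcd_eq]
      exact Nat.Coprime.mul_left hcopm (Nat.coprime_of_mul_modEq_one a₁ (by rw [mul_comm]; exact hab))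
  refine ⟨ZMod.unitOfCoprime r hcopr, ?_, ?_⟩
  · rw [mem_unitsOne]
    ext
    rw [ZMod.unitsMap_val, ZMod.coe_unitOfCoprime, ZMod.cast_natCast hq₀, Units.val_one,
      ← Nat.cast_one, ZMod.natCast_eq_natCast_iff]
    exact hr₂
  · rw [ZMod.coe_unitOfCoprime, ← ZMod.natCast_zmod_val a, ← ZMod.natCast_zmod_val m, ← Nat.cast_mul,
      ZMod.natCast_eq_natCast_iff, ha₁, hm₁', hQ₁, show r * (g * a₁) = g * (r * a₁) by ring]
    refine Nat.ModEq.mul_left' g ?_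
    calc r * a₁ ≡ m₁ * ab * a₁ [MOD Q₁] := hr₁.mul_right _
      _ = m₁ * (a₁ * ab) := by ring
      _ ≡ m₁ * 1 [MOD Q₁] := hab.mul_left _
      _ = m₁ := mul_one _


/-- The stabiliser `Stab = {s ∈ U₁ : s a = a}`. [folklore] -/
def orbitStab {q₀ : ℕ} (hq₀ : q₀ ∣ Q) (a : ZMod Q) : Finset (ZMod Q)ˣ :=
  (unitsOne hq₀).filter fun s : (ZMod Q)ˣ => (s : ZMod Q) * a = a

/-- All points of the orbit have the same number `|Stab|` of representations `m = wa`, `w ∈ U₁`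
(a coset of the stabiliser). [folklore] -/
theorem card_filter_eq_card_orbitStab {q₀ : ℕ} (hq₀ : q₀ ∣ Q) (a : ZMod Q) {w₀ : (ZMod Q)ˣ}
    (hw₀ : w₀ ∈ unitsOne hq₀) :
    ((unitsOne hq₀).filter fun w : (ZMod Q)ˣ => (w : ZMod Q) * a = (w₀ : ZMod Q) * a).card =
      (orbitStab hq₀ a).card := by
  classical
  have himage : ((unitsOne hq₀).filter fun w : (ZMod Q)ˣ => (w : ZMod Q) * a = (w₀ : ZMod Q) * a) =
      (orbitStab hq₀ a).image fun s => w₀ * s := by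
    ext w
    simp only [Finset.mem_filter, Finset.mem_image, orbitStab]
    constructor
    · rintro ⟨hw, hwa⟩
      refine ⟨w₀⁻¹ * w, ⟨mul_mem_unitsOne hq₀ (inv_mem_unitsOne hq₀ hw₀) hw, ?_⟩, by group⟩
      rw [Units.val_mul, mul_assoc, hwa, ← mul_assoc, Units.inv_mul, one_mul]
    · rintro ⟨s, ⟨hs, hsa⟩, rfl⟩
      refine ⟨mul_mem_unitsOne hq₀ hw₀ hs, ?_⟩
      rw [Units.val_mul, mul_assoc, hsa]
  rw [himage, Finset.card_image_of_injective _ (mul_right_injective w₀)]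

/-- **The stabiliser is small**: every `s ∈ Stab` is `≡ 1 (mod lcm(q₀, Q/(a,Q)))`, so
`|Stab| φ(lcm(q₀, Q/(a,Q))) ≤ φ(Q)`. [folklore] -/
theorem card_orbitStab_mul_le {q₀ : ℕ} (hq₀ : q₀ ∣ Q) (a : ZMod Q) {g Q₁ : ℕ} (hg : g = Nat.gcd a.val Q)
    (hQ₁ : Q = g * Q₁) :
    (orbitStab hq₀ a).card * Nat.totient (Nat.lcm q₀ Q₁) ≤ Nat.totient Q := by
  classical
  have hQ0 : Q ≠ 0 := NeZero.ne Q
  have hg0 : 0 < g := by rw [hg]; exact Nat.gcd_pos_of_pos_right _ (Nat.pos_of_ne_zero hQ0)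
  have hQ₁0 : Q₁ ≠ 0 := by rintro rfl; rw [mul_zero] at hQ₁; exact hQ0 hQ₁
  obtain ⟨a₁, ha₁⟩ : g ∣ a.val := by rw [hg]; exact Nat.gcd_dvd_left _ _
  have hcopa : Nat.Coprime a₁ Q₁ := by
    have h := Nat.coprime_div_gcd_div_gcd (m := a.val) (n := Q) (by rw [← hg]; exact hg0)
    rw [← hg, ha₁, hQ₁, Nat.mul_div_cancel_left _ hg0, Nat.mul_div_cancel_left _ hg0] at h
    exact h
  have hL : Nat.lcm q₀ Q₁ ∣ Q := Nat.lcm_dvd hq₀ ⟨g, by rw [hQ₁, mul_comm]⟩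
  haveI : NeZero (Nat.lcm q₀ Q₁) := ⟨fun h => hQ0 (zero_dvd_iff.mp (h ▸ hL))⟩
  -- `Stab ⊆` the fibre of `(ℤ/Q)ˣ → (ℤ/L)ˣ` over `1`
  have hsub : orbitStab hq₀ a ⊆ Finset.univ.filter fun w : (ZMod Q)ˣ => ZMod.unitsMap hL w = 1 := by
    intro s hs
    simp only [orbitStab, Finset.mem_filter] at hs
    obtain ⟨hs₁, hsa⟩ := hs
    rw [Finset.mem_filter]
    refine ⟨Finset.mem_univ _, ?_⟩
    -- `s.val ≡ 1 (mod q₀)` and `(mod Q₁)`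
    have h₁ : (s : ZMod Q).val ≡ 1 [MOD q₀] := val_modEq_one_of_mem_unitsOne hq₀ hs₁
    have h₂ : (s : ZMod Q).val ≡ 1 [MOD Q₁] := by
      obtain ⟨sv, hsv⟩ : ∃ sv : ℕ, sv = (s : ZMod Q).val := ⟨_, rfl⟩
      have hval : sv * a.val ≡ a.val [MOD Q] := by
        rw [← ZMod.natCast_eq_natCast_iff, Nat.cast_mul, hsv, ZMod.natCast_zmod_val,
          ZMod.natCast_zmod_val]
        exact hsa
      rw [ha₁] at hval
      rw [hQ₁] at hval
      rw [← hsv]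
      have h3 : g * (sv * a₁) ≡ g * (1 * a₁) [MOD g * Q₁] := by
        rw [one_mul, show g * (sv * a₁) = sv * (g * a₁) by ring]; exact hval
      have h4 := Nat.ModEq.mul_left_cancel' hg0.ne' h3
      exact Nat.ModEq.cancel_right_of_coprime (c := a₁)
        (by rw [Nat.gcd_comm]; exact hcopa) h4
    have h := Literature.NumberTheory.LFunctions.modEq_lcm h₁ h₂
    ext
    rw [ZMod.unitsMap_val, ZMod.cast_eq_val, Units.val_one, ← Nat.cast_one, ZMod.natCast_eq_natCast_iff]
    exact h
  calc (orbitStab hq₀ a).card * Nat.totient (Nat.lcm q₀ Q₁)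
      ≤ (Finset.univ.filter fun w : (ZMod Q)ˣ => ZMod.unitsMap hL w = 1).card *
          Nat.totient (Nat.lcm q₀ Q₁) := Nat.mul_le_mul_right _ (Finset.card_le_card hsub)
    _ = Nat.totient Q := card_fiber_mul_totient hL 1

/-- The real-number bookkeeping behind `ρ₀ Q ≤ q₀' τ(Q)`: from `S φ(L) ≤ φ(Q) = N φ(q₀)`,
`L ≤ φ(L) τ(L)`, `τ(L) ≤ τ(Q)`, `φ(q₀) ≤ q₀` and `q₀ Q = q₀' L`. [folklore] -/
theorem rho_bound_aux {S N L q₀ Q' q₀' τL τQ φL φQ φq : ℕ} (h1 : S * φL ≤ φQ) (h2 : N * φq = φQ)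
    (h3 : L ≤ φL * τL) (h4 : τL ≤ τQ) (h5 : φq ≤ q₀) (h6 : q₀ * Q' = q₀' * L) (hN : 0 < N)
    (hφL : 0 < φL) : (S : ℝ) / N * Q' ≤ (q₀' : ℝ) * τQ := by
  have h1R : (S : ℝ) * φL ≤ φQ := by exact_mod_cast h1
  have h2R : (N : ℝ) * φq = φQ := by exact_mod_cast h2
  have h3R : (L : ℝ) ≤ φL * τL := by exact_mod_cast h3
  have h4R : (τL : ℝ) ≤ τQ := by exact_mod_cast h4
  have h5R : (φq : ℝ) ≤ q₀ := by exact_mod_cast h5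
  have h6R : (q₀ : ℝ) * Q' = q₀' * L := by exact_mod_cast h6
  have hNR : (0 : ℝ) < N := by exact_mod_cast hN
  have hφLR : (0 : ℝ) < φL := by exact_mod_cast hφL
  rw [div_mul_eq_mul_div, div_le_iff₀ hNR]
  have h7 : (S : ℝ) * φL ≤ N * φq := by rw [h2R]; exact h1R
  have h8 : (S : ℝ) * φL * Q' ≤ N * (q₀' * L) :=
    calc (S : ℝ) * φL * Q' ≤ N * φq * Q' := by gcongr
      _ ≤ N * q₀ * Q' := by gcongr
      _ = N * (q₀' * L) := by rw [mul_assoc, h6R]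
  have h9 : (L : ℝ) ≤ φL * τQ := h3R.trans (by gcongr)
  have h10 : (S : ℝ) * Q' * φL ≤ (q₀' * τQ * N) * φL :=
    calc (S : ℝ) * Q' * φL = S * φL * Q' := by ring
      _ ≤ N * (q₀' * L) := h8
      _ ≤ N * (q₀' * (φL * τQ)) := by gcongr
      _ = (q₀' * τQ * N) * φL := by ring
  exact le_of_mul_le_mul_right h10 hφLR

/-- **Tao–Teräväinen 2022, Lemma 3.9 — the structure of the main term.** For `q₀ ∣ Q` and
`(a,Q) ∣ q₀`, the averaged indicator `ρ(m) = 𝔼_{w ∈ U₁} 1_{m = wa}` equals `ρ₀ 1_𝒜(m)` where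
`𝒜 = {m : m ≡ a (mod q₀'), (m,Q) = (a,Q)}`, `q₀' = (q₀(a,Q), Q) = (q₀ a, Q)`, and
`0 ≤ ρ₀ ≤ q₀' τ(Q)/Q` (the source computes `ρ₀ = α q₀'/q` exactly with
`α = ∏_{p ∣ q/q₀', p ∤ q₀'/(a,q)} p/(p-1)`; only the upper bound is recorded here).
[cite: TaoTeravainen2021, Lemma 3.9] -/
theorem orbitWeight_structure {q₀ : ℕ} (hq₀ : q₀ ∣ Q) {a : ZMod Q} (ha : Nat.gcd a.val Q ∣ q₀) :
    ∃ ρ₀ : ℝ, 0 ≤ ρ₀ ∧ ρ₀ * Q ≤ (Nat.gcd (q₀ * a.val) Q : ℝ) * (Nat.divisors Q).card ∧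
      ∀ m : ZMod Q, orbitWeight hq₀ a m =
        if (m.val ≡ a.val [MOD Nat.gcd (q₀ * a.val) Q] ∧ Nat.gcd m.val Q = Nat.gcd a.val Q)
          then ((ρ₀ : ℝ) : ℂ) else 0 := by
  classical
  have hQ0 : Q ≠ 0 := NeZero.ne Q
  have hQpos : 0 < Q := Nat.pos_of_ne_zero hQ0
  obtain ⟨g, hg⟩ : ∃ g : ℕ, g = Nat.gcd a.val Q := ⟨_, rfl⟩
  have hg0 : 0 < g := by rw [hg]; exact Nat.gcd_pos_of_pos_right _ hQpos
  obtain ⟨Q₁, hQ₁⟩ : g ∣ Q := by rw [hg]; exact Nat.gcd_dvd_right _ _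
  obtain ⟨a₁, ha₁⟩ : g ∣ a.val := by rw [hg]; exact Nat.gcd_dvd_left _ _
  have hQ₁0 : Q₁ ≠ 0 := by rintro rfl; rw [mul_zero] at hQ₁; exact hQ0 hQ₁
  have hq₀0 : q₀ ≠ 0 := fun h => hQ0 (zero_dvd_iff.mp (h ▸ hq₀))
  haveI : NeZero q₀ := ⟨hq₀0⟩
  have hcopa : Nat.Coprime a₁ Q₁ := by
    have h := Nat.coprime_div_gcd_div_gcd (m := a.val) (n := Q) (by rw [← hg]; exact hg0)
    rw [← hg, ha₁, hQ₁, Nat.mul_div_cancel_left _ hg0, Nat.mul_div_cancel_left _ hg0] at h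
    exact h
  have hq₀' : Nat.gcd (q₀ * a.val) Q = g * Nat.gcd q₀ Q₁ := by
    rw [ha₁, hQ₁, show q₀ * (g * a₁) = g * (q₀ * a₁) by ring, Nat.gcd_mul_left,
      Nat.Coprime.gcd_mul_right_cancel q₀ hcopa]
  obtain ⟨N, hN⟩ : ∃ N : ℕ, N = (unitsOne hq₀).card := ⟨_, rfl⟩
  have hNpos : 0 < N := by rw [hN]; exact card_unitsOne_pos hq₀
  obtain ⟨S, hS⟩ : ∃ S : ℕ, S = (orbitStab hq₀ a).card := ⟨_, rfl⟩
  refine ⟨(S : ℝ) / N, div_nonneg (Nat.cast_nonneg _) (Nat.cast_nonneg _), ?_, ?_⟩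
  · -- `ρ₀ Q ≤ q₀' τ(Q)`
    obtain ⟨L, hLdef⟩ : ∃ L : ℕ, L = Nat.lcm q₀ Q₁ := ⟨_, rfl⟩
    have hLQ : L ∣ Q := by rw [hLdef]; exact Nat.lcm_dvd hq₀ ⟨g, by rw [hQ₁, mul_comm]⟩
    have hL0 : L ≠ 0 := fun h => hQ0 (zero_dvd_iff.mp (h ▸ hLQ))
    have h1 : S * Nat.totient L ≤ Nat.totient Q := by
      rw [hS, hLdef]; exact card_orbitStab_mul_le hq₀ a hg hQ₁
    have h2 : N * Nat.totient q₀ = Nat.totient Q := by rw [hN]; exact card_unitsOne_mul_totient hq₀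
    have h3 : L ≤ Nat.totient L * (Nat.divisors L).card := Literature.NumberTheory.Sieve.self_le_totient_mul_card_divisors L
    have h4 : (Nat.divisors L).card ≤ (Nat.divisors Q).card := card_divisors_le_of_dvd hLQ hQ0
    have h5 : Nat.totient q₀ ≤ q₀ := Nat.totient_le q₀
    have h6 : q₀ * Q = Nat.gcd (q₀ * a.val) Q * L := by
      rw [hq₀', hLdef, mul_assoc, Nat.gcd_mul_lcm, hQ₁]; ring
    have hφL : 0 < Nat.totient L := Nat.totient_pos.mpr (Nat.pos_of_ne_zero hL0)
    exact rho_bound_aux h1 h2 h3 h4 h5 h6 hNpos hφL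
  · -- the structure of `ρ`
    intro m
    by_cases hm : m.val ≡ a.val [MOD Nat.gcd (q₀ * a.val) Q] ∧ Nat.gcd m.val Q = Nat.gcd a.val Q
    · rw [if_pos hm]
      obtain ⟨w₀, hw₀, hw₀a⟩ := exists_unit_of_mem hq₀ ha hm.1 hm.2
      unfold orbitWeight
      rw [← hw₀a, card_filter_eq_card_orbitStab hq₀ a hw₀, ← hS, ← hN, Complex.ofReal_div,
        Complex.ofReal_natCast, Complex.ofReal_natCast]
    · rw [if_neg hm]
      unfold orbitWeight
      rw [div_eq_zero_iff]
      left
      rw [Nat.cast_eq_zero, Finset.card_eq_zero, Finset.filter_eq_empty_iff]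
      intro w hw hwa
      exact hm (hwa ▸ orbit_subset hq₀ a hw)


/-- **Tao–Teräväinen 2022, Lemma 3.9 (Modified Fourier expansion).** Let `q₀ ∣ Q` with
`(a, Q) ∣ q₀` and let `f : (ℤ/Qℤ)² → ℂ` be `1`-bounded and `q₀`-periodic in each variable. Then
`f(n₁,n₂) 1_{n₁n₂ = a} = f(n₁,n₂) ρ₀ 1_{n₁n₂ ≡ a (q₀')} 1_{(n₁n₂,Q) = (a,Q)} + ∑_{u₁,u₂} c_{u₁,u₂} e_Q(u₁n₁+u₂n₂)`
where `q₀' = (q₀(a,Q), Q)` (`= (q₀a, Q)`), `0 ≤ ρ₀ ≤ q₀' τ(Q)/Q` (the source's `α q₀'/q` with the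
explicit `α ≤ τ(Q)` replaced by the bound), the coefficients vanish unless `Q/q₀ ∤ u₁, u₂`
(here: `c_u = 0` whenever `u₁ q₀ = 0` or `u₂ q₀ = 0` in `ℤ/Qℤ`), and
`|c_{u₁,u₂}| ≤ 2 τ(q₀)² q₀^{3/2} τ(Q) Q^{-3/2} (u₁,u₂,Q)^{1/2}`.
[cite: TaoTeravainen2021, Lemma 3.9] -/
theorem modifiedFourierExpansion {q₀ : ℕ} (hq₀ : q₀ ∣ Q) {a : ZMod Q} (ha : Nat.gcd a.val Q ∣ q₀)
    {f : ZMod Q × ZMod Q → ℂ} (hf1 : ∀ n, ‖f n‖ ≤ 1)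
    (hfp₁ : ∀ n, f (n + ((q₀ : ZMod Q), 0)) = f n) (hfp₂ : ∀ n, f (n + (0, (q₀ : ZMod Q))) = f n) :
    ∃ (ρ₀ : ℝ) (c : ZMod Q × ZMod Q → ℂ),
      0 ≤ ρ₀ ∧ ρ₀ * Q ≤ (Nat.gcd (q₀ * a.val) Q : ℝ) * (Nat.divisors Q).card ∧
      (∀ u : ZMod Q × ZMod Q, (u.1 * (q₀ : ZMod Q) = 0 ∨ u.2 * (q₀ : ZMod Q) = 0) → c u = 0) ∧
      (∀ u : ZMod Q × ZMod Q, ‖c u‖ ≤ 2 * (((Nat.divisors q₀).card : ℝ) ^ 2 * ((q₀ : ℝ) * Real.sqrt q₀) *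
        (Nat.divisors Q).card * Real.sqrt (Nat.gcd (Nat.gcd u.1.val u.2.val) Q) /
          ((Q : ℝ) * Real.sqrt Q))) ∧
      ∀ n : ZMod Q × ZMod Q, (if n.1 * n.2 = a then f n else 0) =
        f n * (if ((n.1 * n.2).val ≡ a.val [MOD Nat.gcd (q₀ * a.val) Q] ∧
          Nat.gcd (n.1 * n.2).val Q = Nat.gcd a.val Q) then ((ρ₀ : ℝ) : ℂ) else 0) +
        ∑ u : ZMod Q × ZMod Q, c u * eQ u n := by
  obtain ⟨ρ₀, hρ₀, hρQ, hρ⟩ := orbitWeight_structure hq₀ ha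
  refine ⟨ρ₀, modifiedCoeff hq₀ f a, hρ₀, hρQ, fun u hu => modifiedCoeff_eq_zero hq₀ hfp₁ hfp₂ a hu,
    fun u => norm_modifiedCoeff_le hq₀ ha hf1 hfp₁ hfp₂ u, fun n => ?_⟩
  rw [indicator_mul_eq_orbitWeight_add_sum hq₀ f a n, hρ (n.1 * n.2)]

end TaoTeravainen

end Literature.Barriers.Parity
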